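import Mathlib.RingTheory.Unramified.LocalRing
import Literature.NumberTheory.Automorphic.ReciprocityGLnProofs
import HarnessLib

/-!
# Harris–Lan–Taylor–Thorne 2016, Cor. 6.27: the `2n`-dimensional representations `R_{p,ı}(π, N)`

Topic `Literature/NumberTheory/Automorphic` (vocabulary of `ReciprocityGLn` and
`ReciprocityGLnProofs`: `CuspidalAutomorphicRepData`, `IsRegularAlgebraic`, `HasSatakeParamAt`,
`IsUnramifiedAbove`, `arithFrobPolyOfSatake`, `FramedGaloisRep.IsUnramifiedAt`,
`HasFrobCharpolyAt`).

This file vendors, as a **named fact** (D-0014), the *automorphic input* of the existence half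
of Harris–Lan–Taylor–Thorne's Thm. A (lower layer 2 of `ReciprocityGLnProofs`): the output of
the rigid-cohomology construction of §6 of the paper, Cor. 6.27 (p. 225), in the form in which
the proof of Thm. 7.13 (p. 232) consumes it at the unramified places.

Setting (HLTT p. 11, standing notation): `F⁺` totally real, `F₀` imaginary quadratic,
`F = F₀F⁺` (equivalently: `F` is a CM field containing an imaginary quadratic field `F₀`),
`p` a rational prime which splits in `F₀`, `ı : ℚ̄_p ≅ ℂ`.  Cor. 6.27, as printed: "Suppose
that `n > 1`, that `ρ` is an irreducible algebraic representation of `L_{n,(n),lin}` on a finite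
dimensional `ℂ`-vector space and that `π` is a cuspidal automorphic representation of
`L_{n,(n),lin}(𝔸)` [`= GL_n(𝔸_F)`] so that `π_∞` has the same infinitesimal character as `ρ^∨`.
Then, for all sufficiently large integers `N`, there is a continuous, semi-simple
representation `R_{p,ı}(π, N) : G_F → GL_{2n}(ℚ̄_p)` with the following property: Suppose that
`q ≠ p` is a rational prime which either splits in `F₀` or is unramified in `F`. Suppose
further that `π` is unramified at all primes of `F` above `q`. If `v | q` is a prime of `F`,
then `R_{p,ı}(π, N)|^{F-ss}_{W_{F_v}} ≅ ı⁻¹ rec_{F_v}(π_v |det|_v^{(1-n)/2}) ⊕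
ı⁻¹ rec_{F_{ᶜv}}(π_{ᶜv} |det|_{ᶜv}^{(1-n)/2})^{∨,c} ε_p^{1-2n-2N}`."

What is vendored (`corollary627_splitOrUnramified`) is the following **consequence**, in the
tree's vocabulary (no Weil–Deligne representations, no `rec`), for a *fixed* imaginary quadratic
subfield `F₀ ⊆ F` in which `p` splits (the datum the first printed alternative on `q` refers
to): for `q ≠ p` which either splits in `F₀` or is unramified in `F`, with `π` unramified above
`q` and `v | q`, both summands are unramified, so `R_{p,ı}(π, N)` is unramified at `v`, and the
characteristic polynomial of an arithmetic Frobenius at `v` is the product of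
`arithFrobPolyOfSatake ı q_v n α_v` (the factor of the first summand — the normalisation of
`ReciprocityGLn`, review 13: arithmetic Frobenius has the inverse eigenvalues of
`ı⁻¹ rec(π_v|det|_v^{(1-n)/2})(Frob_v^{geom})`) and of a factor `∏_{b ∈ B_v} (X - b q_v^{-2N})`,
where `B_v` is an `n`-element multiset of non-zero elements of `ℚ̄_p` **depending on `v` (and
`π`, `ı`) but not on `N`**: the eigenvalues of `ı⁻¹ rec_{F_{ᶜv}}(π_{ᶜv}|det|^{(1-n)/2})^{∨,c}
ε_p^{1-2n}` at an arithmetic Frobenius at `v`, the remaining factor `ε_p^{-2N}` contributing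
`q_v^{-2N}` (the `p`-adic cyclotomic character takes the value `q_v` on arithmetic Frobenii at
`v ∤ p`, Serre, *Abelian `ℓ`-adic representations*, I-1.2).  The multiset `B_v` is stated
existentially, so that no convention on `rec`, duals or complex conjugation enters; this is
weaker than the printed corollary and is exactly the shape consumed by the group-theoretic
Prop. 7.12 (`Literature.NumberTheory.GaloisRepresentations.HarrisLanTaylorThorne2016.prop712`, `GaloisRepresentations/
TwistedSumDecomposition`) in the proof of Thm. 7.13 (p. 232: `μ = ε_p^{-2}`,
`𝔈²_{Frob_v}` = the roots of the second factor, `ℳ` = all sufficiently large integers), carried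
out in `HarrisLanTaylorThorneThm713` / `HarrisLanTaylorThorneThm713Proofs` (`theorem713_of`).
(Until 2026-08-15 the file also vendored separately the same consequence with the alternative
"`q` splits in `F₀`" dropped, `corollary627_unramified`; being a corollary of
`corollary627_splitOrUnramified` it was retired — one named fact per printed result.)

* "`K` unramified above the rational prime `q`" is Mathlib's
  `Algebra.IsUnramifiedIn (𝓞 K) (Ideal.span {(q : ℤ)})` (`RingTheory/Unramified/Locus`: every
  prime of `𝓞 K` over `(q)` is unramified over `ℤ`; for `q` prime `⟺ ¬ q ∣ discr K`, Mathlib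
  `isUnramifiedIn_iff_forall_of_isDedekindDomain`, `not_dvd_discr_iff_forall_mem`).
* `NumberField.HasSplitImaginaryQuadraticSubfield K p` — `K` contains an imaginary quadratic
  field `F₀` (`finrank ℚ F₀ = 2 ∧ IsTotallyComplex F₀`, verbatim the tree's
  `Literature.IsImaginaryQuadratic F₀` of `EllipticCurves/HeegnerPoints`, not imported here) in which
  `p` splits (HLTT's standing hypothesis `F = F₀F⁺`, `p` split in `F₀`).
* `NumberField.HasTwoPrimesOver F₀ q` — the rational prime `q` lies below two distinct primes
  of `F₀` (for `F₀` quadratic: `q` splits in `F₀`; the rendering already used for `p` inside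
  `HasSplitImaginaryQuadraticSubfield`, `hasSplitImaginaryQuadraticSubfield_iff`).
* `Literature.NumberTheory.Automorphic.HarrisLanTaylorThorne2016.corollary627_splitOrUnramified` — the named fact: the
  above consequence of Cor. 6.27 with **both** printed alternatives on `q` ("either splits in
  `F₀` or is unramified in `F`"), from which Thm. 7.13 is proved as printed (both branches) in
  `HarrisLanTaylorThorneThm713Proofs`.

## References

* M. Harris, K.-W. Lan, R. Taylor, J. Thorne, *On the rigid cohomology of certain Shimura
  varieties*, Res. Math. Sci. 3:37 (2016): p. 11 (notation), Cor. 6.26–6.27 (p. 225),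
  Thm. 7.13 and its proof (p. 232). [HarrisLanTaylorThorneRMS2016]
* J.-P. Serre, *Abelian ℓ-adic representations and elliptic curves* (1968), Ch. I §1.2 (the
  cyclotomic character). [SerreAbelianLadic1968]
-/

noncomputable section

open scoped NumberField Polynomial
open NumberField IsDedekindDomain Field Polynomial Literature.NumberTheory.Automorphic Literature.NumberTheory.GaloisRepresentations

/-! ## The arithmetic side condition on `K` -/

namespace NumberField

/-- `K` **contains an imaginary quadratic field in which `p` splits**: there is a subfield
`F₀ ⊆ K`, quadratic over `ℚ` and totally complex (Mathlib `NumberField.IsTotallyComplex`; the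
conjunction `finrank ℚ F₀ = 2 ∧ IsTotallyComplex F₀` is verbatim the tree's
`Literature.IsImaginaryQuadratic F₀`, `EllipticCurves/HeegnerPoints`, whose import is avoided here),
such that `p 𝓞_{F₀}` is divisible by two distinct primes (for a quadratic field: `p` splits).
This is Harris–Lan–Taylor–Thorne's standing hypothesis "`F = F₀ F⁺`, `p` splits in `F₀`"
(p. 11) on a CM field `F`. [cite: HarrisLanTaylorThorneRMS2016, §1 (p. 11)] -/
def HasSplitImaginaryQuadraticSubfield (K : Type*) [Field K] [NumberField K] (p : ℕ) : Prop :=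
  ∃ F₀ : IntermediateField ℚ K, (Module.finrank ℚ F₀ = 2 ∧ IsTotallyComplex F₀) ∧
    ∃ w w' : HeightOneSpectrum (𝓞 F₀), w ≠ w' ∧
      ((p : ℕ) : 𝓞 F₀) ∈ w.asIdeal ∧ ((p : ℕ) : 𝓞 F₀) ∈ w'.asIdeal

end NumberField

/-! ## Cor. 6.27 at the unramified places of `π` -/

namespace NumberField

/-- The rational prime `q` **lies below two distinct primes** of the number field `F₀`: there are
finite places `w ≠ w'` of `F₀` with `q ∈ w`, `q ∈ w'`.  For `F₀` quadratic over `ℚ` this says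
exactly that `q` *splits* in `F₀` (`q 𝓞_{F₀} = w w'`, `w ≠ w'`: a quadratic field has at most
two primes over `q`, and two iff `q` splits); it is the rendering of "`p` splits in `F₀`" used
inside `HasSplitImaginaryQuadraticSubfield` (`hasSplitImaginaryQuadraticSubfield_iff`).
[cite: HarrisLanTaylorThorneRMS2016, §1 (p. 11) and Cor. 6.27 (p. 225)] -/
def HasTwoPrimesOver (F₀ : Type*) [Field F₀] [NumberField F₀] (q : ℕ) : Prop :=
  ∃ w w' : HeightOneSpectrum (𝓞 F₀), w ≠ w' ∧
    ((q : ℕ) : 𝓞 F₀) ∈ w.asIdeal ∧ ((q : ℕ) : 𝓞 F₀) ∈ w'.asIdeal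

/-- `HasSplitImaginaryQuadraticSubfield K p` unfolds to: some imaginary quadratic subfield
`F₀ ⊆ K` has two primes over `p`. [folklore] -/
theorem hasSplitImaginaryQuadraticSubfield_iff (K : Type*) [Field K] [NumberField K] (p : ℕ) :
    HasSplitImaginaryQuadraticSubfield K p ↔
      ∃ F₀ : IntermediateField ℚ K, (Module.finrank ℚ F₀ = 2 ∧ IsTotallyComplex F₀) ∧
        HasTwoPrimesOver F₀ p :=
  Iff.rfl

end NumberField

namespace Literature.NumberTheory.Automorphic.HarrisLanTaylorThorne2016

/-- **Harris–Lan–Taylor–Thorne 2016, Cor. 6.27 — consequence at the unramified places of `π`,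
both alternatives on `q`.**  Let `K` be a CM field, `F₀ ⊆ K` an imaginary quadratic subfield
(`finrank ℚ F₀ = 2 ∧ IsTotallyComplex F₀`) in which the prime `p` splits (`HasTwoPrimesOver F₀ p`)
— HLTT's standing notation `F = F₀F⁺`, `p` split in `F₀` (p. 11) — `n > 1`, `π` a cuspidal
automorphic representation of `GL_n(𝔸_K)` with `π_∞` regular algebraic, and `ı : ℚ̄_p ≃ ℂ`.
Then there are `N₀`, continuous semisimple `R_N : Γ_K → GL_{2n}(ℚ̄_p)` (`N ≥ N₀`; the printed
`R_{p,ı}(π, N)`) and, for each finite place `v`, an `n`-element multiset `B_v` of non-zero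
elements of `ℚ̄_p`, such that for every rational prime `q ≠ p` which **either splits in `F₀`
(`HasTwoPrimesOver F₀ q`) or is unramified in `K`** (Mathlib `Algebra.IsUnramifiedIn (𝓞 K) (q)`)
and above which `π` is unramified, every `v | q`, every Satake parameter `α` of `π` at `v` and
every `N ≥ N₀`: `R_N` is unramified at `v` and the characteristic polynomial of (any) arithmetic
Frobenius at `v` on `R_N` is `arithFrobPolyOfSatake ı q_v n α · ∏_{b ∈ B_v} (X - b q_v^{-2N})`.
This is implied by the printed Cor. 6.27 — "Suppose that `q ≠ p` is a rational prime which either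
splits in `F₀` or is unramified in `F`. Suppose further that `π` is unramified at all primes of
`F` above `q`. If `v|q` is a prime of `F`, then `R_{p,ı}(π, N)|^{F-ss}_{W_{F_v}} ≅
ı⁻¹rec(π_v|det|^{(1-n)/2}) ⊕ ı⁻¹rec(π_{ᶜv}|det|^{(1-n)/2})^{∨,c} ε_p^{1-2n-2N}`", both summands
being unramified at such `v` in either alternative (`π_v`, `π_{ᶜv}` unramified, `v ∤ p`), `B_v` =
the arithmetic-Frobenius eigenvalues of the second summand for `N = 0`, the factor `ε_p^{-2N}`
contributing `q_v^{-2N}` — and is weaker than it (existential `B_v`); the module docstring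
explains the rendering.  The printed alternative "`q` splits in `F₀`" refers to the fixed
subfield `F₀`, whence the explicit quantification over `F₀`.  Named fact (D-0014): §6 of the
paper (rigid cohomology of the ordinary locus of the `U(n,n)`-Shimura variety, `p`-adic
interpolation) is far beyond the
library.  [cite: HarrisLanTaylorThorneRMS2016, Cor. 6.27 (p. 225); proof of Thm. 7.13 (p. 232)] -/
def corollary627_splitOrUnramified : Prop :=
  ∀ {n : ℕ} {K : Type} [Field K] [NumberField K] (hcpt : isCompact_glFiniteIntegralLevel n K)
    (p : ℕ) [Fact p.Prime], 1 < n → IsCMField K →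
    ∀ (F₀ : IntermediateField ℚ K), Module.finrank ℚ F₀ = 2 ∧ IsTotallyComplex F₀ →
    HasTwoPrimesOver F₀ p →
    ∀ (π : CuspidalAutomorphicRepData n K hcpt), π.1.IsRegularAlgebraic →
    ∀ (ι : PadicAlgCl p ≃+* ℂ),
    ∃ (N₀ : ℕ) (R : ℕ → FramedGaloisRep K (PadicAlgCl p) (2 * n))
      (B : HeightOneSpectrum (𝓞 K) → Multiset (PadicAlgCl p)),
      (∀ N, N₀ ≤ N → (R N).toGaloisRep.IsSemisimple) ∧
      (∀ v, Multiset.card (B v) = n ∧ (0 : PadicAlgCl p) ∉ B v) ∧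
      ∀ q : ℕ, q.Prime → q ≠ p →
        (HasTwoPrimesOver F₀ q ∨ Algebra.IsUnramifiedIn (𝓞 K) (Ideal.span {(q : ℤ)})) →
        π.1.IsUnramifiedAbove q →
        ∀ v : HeightOneSpectrum (𝓞 K), ((q : ℕ) : 𝓞 K) ∈ v.asIdeal →
        ∀ α : Multiset ℂ, π.1.HasSatakeParamAt v α →
        ∀ N, N₀ ≤ N →
          (R N).IsUnramifiedAt v ∧
          (R N).HasFrobCharpolyAt v
            (arithFrobPolyOfSatake ι v.residueCard n α *
              ((B v).map fun b ↦
                X - C (b * ((v.residueCard : PadicAlgCl p)⁻¹) ^ (2 * N))).prod)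

end Literature.NumberTheory.Automorphic.HarrisLanTaylorThorne2016
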